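import Summits.SmoothPoincare4.SmoothPoincare4.Theses.DottedCircleRasmussen
import Summits.SmoothPoincare4.SmoothPoincare4.Theorems.DcrGap.Negative.NoDiscNormalForm
import Literature.Topology.FourManifolds.MMSWRasmussenFacts
import Literature.Topology.FourManifolds.GaussDiagrams
import Literature.Topology.FourManifolds.LeeRasmussen

/-!
# Crux `DottedCircleRasmussen.DcrGap` (stmt-SmoothPoincare4-16128) — strategist r1 sketch

Two typed objects behind the r1 census (`Cruxes/DcrGap/STRATEGY-CENSUS.md`, r1) and the crux idea
`named-cell-schema`:

* §1 THE NAMED-CELL SCHEMA.  The r0 census (S4 (i)) recorded the single-instance strengthening of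
  the crux as "not expressible — the tree has no Kirby-diagram → smooth-manifold formalisation for
  any candidate".  It IS expressible at the level the certificate is actually computed at: signed
  Gauss diagrams (`GaussDiagram`, `Knot.HasGaussDiagram`, `GaussDiagram.rasmussenInvariant` of
  `GaussDiagrams` / `LeeRasmussen`) of the finite approximations `MMSW.finiteApprox k k₀ K`
  (`MMSWRasmussen`).  `CellDatum k k₀ G₀ G₁` says: some null-homologous, core-missing model knot
  `K ⊂ ∂D_k`, dotted-slice in some homotopy sphere, has untwisted picture reading `G₀` and
  `k₀`-twisted picture reading `G₁`, with `k₀` above MMSW's threshold `⌈(n⁺(G₀)+2)/2⌉`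
  (`4 k₀ ≥ n(G₀) + writhe(G₀) + 4`).  For EXPLICIT literals `G₀, G₁` (as the tree's
  `gaussDiagram16n68278`) this is a statement a prover can discharge by construction (draw the
  candidate), `CellCertificate G₁ := 1 ≤ G₁.rasmussenInvariant` is ONE Khovanov computation, and
  `dcrGap_of_cell` (sorry-free) closes the crux from the two plus MMSW Prop. 8.2 (i) (threshold,
  Literature) and Lemma 8.19 (Literature).  What is missing is not vocabulary but a NAMEABLE
  `(Σ, K₀)` whose `G₁` is computable — see the census, obstructions O1–O4.
* §2 THE SHADOW SIEVE (MMSW Prop. 8.2 (iii)–(iv), p. 23 of arXiv:1910.08195, verified on the held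
  text): `s₋(K) ≤ s(D(0⃗)) ≤ s₊(K)` for EVERY picture `D` of `K`; hence a certificate
  `s₋ > 0` (resp. `s₊ < 0`) forces the SHADOW knot `D(0⃗)` — the picture with the dotted circles
  erased, a small `S³`-knot — to have `s > 0` (resp. `< 0`) in every picture.  Stated as the two
  named-fact-shaped Props `ShadowUpperBound`, `ShadowLowerBound` (hypotheses, never facts, D-0026)
  and the consequence `shadow_sign_of_certificate`.  It is a cheap pre-filter on candidate
  attaching circles (no threshold computation needed) and constrains WITNESSES only.

Nothing here is a line: no `stub_*`, no registration.  `lean check` target: rc 0, no sorry.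
-/

noncomputable section

set_option linter.dupNamespace false

open scoped Manifold ContDiff Topology
open Function Set
open Literature.Topology.FourManifolds Literature.Topology.FourManifolds.MMSW
open Literature.AlgebraicTopology.Homotopy.HopfFibration (wC)
open Summit.SmoothPoincare4.SmoothPoincare4.Theses.DottedCircleRasmussen

namespace Summit.SmoothPoincare4.SmoothPoincare4.Cruxes.DcrGap.StrategistR1

/-- Local notation: `𝔼 n` is the model Euclidean space `EuclideanSpace ℝ (Fin n)`. -/
local notation "𝔼 " n:arg => EuclideanSpace ℝ (Fin n)

/-- Local notation: `𝕊 n` is the unit sphere in `EuclideanSpace ℝ (Fin (n + 1))`. -/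
local notation "𝕊 " n:arg => (Metric.sphere (0 : EuclideanSpace ℝ (Fin (n + 1))) 1)

/-! ## §1 The named-cell schema -/

/-- **Dotted-slice in some homotopy 4-sphere** (the positive datum of the crux, route binders
verbatim). [folklore] -/
def HomotopySphereSlice (k : ℕ) (K : 𝕊 1 → 𝔼 4) : Prop :=
  ∃ (M : Type) (_ : TopologicalSpace M) (_ : T2Space M) (_ : SecondCountableTopology M)
    (_ : ChartedSpace (𝔼 4) M) (_ : IsManifold (𝓡 4) ∞ M),
    Nonempty (ContinuousMap.HomotopyEquiv M (𝕊 4)) ∧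
      ∃ (e : 𝔼 4 → M) (f : 𝔼 2 → M), IsSliceDiscInComplement k K M e f

/-- **NAMED CELL, datum half.**  For explicit `k`, twist level `k₀` and Gauss diagrams `G₀`
(untwisted picture, fixing `n⁺`) and `G₁` (picture at level `k₀`): some null-homologous,
core-missing model knot `K ⊂ ∂D_k` that is dotted-slice in some homotopy 4-sphere has
`finiteApprox k 0 K` reading `G₀` and `finiteApprox k k₀ K` reading `G₁`, and `k₀` is at or above
MMSW's threshold `⌈(n⁺(G₀) + 2)/2⌉`, written `n(G₀) + writhe(G₀) + 4 ≤ 4 k₀`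
(`n⁺ = (n + writhe)/2`).  For literal `G₀, G₁` drawn from a Kirby diagram of a homotopy sphere
(attaching circle of a 2-handle slid to class `0`), TRUE by construction and provable.
[cite: ManolescuMarengonSarkarWillis2023, Prop. 8.2] -/
def CellDatum (k : ℕ) (k₀ : ℤ) (G₀ G₁ : GaussDiagram) : Prop :=
  ∃ K : 𝕊 1 → 𝔼 4, IsModelKnot k K ∧ IsNullHomologous k K ∧ (∀ t, wC (K t) ≠ 0) ∧
    HomotopySphereSlice k K ∧
    (∃ K₃ : Knot, ⇑K₃ = finiteApprox k 0 K ∧ K₃.HasGaussDiagram G₀) ∧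
    (∃ K₃ : Knot, ⇑K₃ = finiteApprox k k₀ K ∧ K₃.HasGaussDiagram G₁) ∧
    (G₀.n : ℤ) + G₀.writhe + 4 ≤ 4 * k₀

/-- **NAMED CELL, certificate half**: the Rasmussen invariant of the explicit diagram `G₁` is
positive — ONE Khovanov–Lee computation (decidable in principle; in practice KnotJob/khoca-class
software, absent from this hub's compute pool). [cite: Rasmussen2010, Def. 3.4] -/
def CellCertificate (G₁ : GaussDiagram) : Prop :=
  1 ≤ G₁.rasmussenInvariant

/-- **MMSW Prop. 8.2 (i) with the explicit threshold (Thm. 1.4 = Thm. 3.3), in the tree's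
vocabulary** (Literature debt; TRUE in print; the tree's `MMSW.eventually_approxHasRasmussen` keeps
only eventual constancy): if the untwisted picture of the null-homologous core-missing model knot
`K` reads `G₀` then for every `k' ≥ k₀ ≥ ⌈(n⁺(G₀)+2)/2⌉` the picture at level `k'` has Rasmussen
invariant `s(G₁)`, `G₁` the reading at level `k₀` (packaging: the picture at level `k'` is a smooth
`S³`-knot isotopic to MMSW's `D(k⃗')`, and `s` is an isotopy invariant — Rasmussen Thm. 1).
[cite: ManolescuMarengonSarkarWillis2023, Prop. 8.2 (i)] -/
def ThresholdFact : Prop :=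
  ∀ {k : ℕ} {K : 𝕊 1 → 𝔼 4} (K₀₃ K₃ : Knot) (G₀ G₁ : GaussDiagram) (k₀ : ℤ),
    IsModelKnot k K → IsNullHomologous k K → (∀ t, wC (K t) ≠ 0) →
    ⇑K₀₃ = finiteApprox k 0 K → K₀₃.HasGaussDiagram G₀ →
    ⇑K₃ = finiteApprox k k₀ K → K₃.HasGaussDiagram G₁ →
    (G₀.n : ℤ) + G₀.writhe + 4 ≤ 4 * k₀ →
    ∀ k', k₀ ≤ k' → ApproxHasRasmussen k k' K G₁.rasmussenInvariant

/-- From the threshold fact, a cell datum yields `s₋(K) = s(G₁)` in the tree's sense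
(`MMSW.HasSMinus`, representative `K` itself). [cite: ManolescuMarengonSarkarWillis2023, Prop. 8.2 (i)] -/
theorem hasSMinus_of_cell (hT : ThresholdFact) {k : ℕ} {k₀ : ℤ} {G₀ G₁ : GaussDiagram}
    {K : 𝕊 1 → 𝔼 4} (hK : IsModelKnot k K) (h0 : IsNullHomologous k K)
    (hw : ∀ t, wC (K t) ≠ 0) {K₀₃ K₃ : Knot} (hK₀₃ : ⇑K₀₃ = finiteApprox k 0 K)
    (hG₀ : K₀₃.HasGaussDiagram G₀) (hK₃ : ⇑K₃ = finiteApprox k k₀ K)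
    (hG₁ : K₃.HasGaussDiagram G₁) (hthr : (G₀.n : ℤ) + G₀.writhe + 4 ≤ 4 * k₀) :
    HasSMinus k K G₁.rasmussenInvariant :=
  ⟨h0, K, IsModelIsotopic.refl hK, hw, k₀, hT K₀₃ K₃ G₀ G₁ k₀ hK h0 hw hK₀₃ hG₀ hK₃ hG₁ hthr⟩

/-- **THE NAMED CELL CLOSES THE CRUX** (sorry-free composition): datum + threshold (Literature) +
certificate (computation) + MMSW Lemma 8.19 (Literature, the tree's named fact
`MMSW.sMinus_nonpos_of_isModelSliceDisc`) ⇒ `DcrGap`, through the landed normal form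
`Negative.dcrGap_iff_modelForm` (no model slice disc: one would force `s₋ ≤ 0 < 1 ≤ s₋`).
[cite: ManolescuMarengonSarkarWillis2023, Lemma 8.19] -/
theorem dcrGap_of_cell {k : ℕ} {k₀ : ℤ} {G₀ G₁ : GaussDiagram} (hD : CellDatum k k₀ G₀ G₁)
    (hT : ThresholdFact) (hC : CellCertificate G₁)
    (h819 : MMSW.sMinus_nonpos_of_isModelSliceDisc) : DcrGap := by
  obtain ⟨K, hK, h0, hw, hS, ⟨K₀₃, hK₀₃, hG₀⟩, ⟨K₃, hK₃, hG₁⟩, hthr⟩ := hD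
  have hs : HasSMinus k K G₁.rasmussenInvariant :=
    hasSMinus_of_cell hT hK h0 hw hK₀₃ hG₀ hK₃ hG₁ hthr
  rw [Theorems.DcrGap.Negative.dcrGap_iff_modelForm]
  refine ⟨k, K, hK, hS, fun g hg => ?_⟩
  have h := h819 hs hg
  unfold CellCertificate at hC
  omega

/-- The cell is NOT the crux in disguise: it fixes `k`, the knot's pictures and the detector; the
crux only follows from it through two printed theorems.  Conversely `DcrGap` gives no cell
(a gap needs no `s`-certificate).  Recorded: the converse direction available is only the
trivial one from a cell datum to the positive datum of the crux. [folklore] -/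
theorem homotopySphereSlice_of_cell {k : ℕ} {k₀ : ℤ} {G₀ G₁ : GaussDiagram}
    (hD : CellDatum k k₀ G₀ G₁) : ∃ K, IsModelKnot k K ∧ HomotopySphereSlice k K := by
  obtain ⟨K, hK, -, -, hS, -⟩ := hD
  exact ⟨K, hK, hS⟩

/-! ## §2 The shadow sieve (MMSW Prop. 8.2 (iii)–(iv)) -/

/-- **MMSW Prop. 8.2 (iii)**: `s₋(K) ≤ s(D(0⃗))` — the untwisted picture (the SHADOW: dotted
circles erased) bounds `s₋` from above, for every core-missing representative.  (Printed proof: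
a null-homologous concordance in `#^{kr} CP²bar` from `D(0⃗)` to `D(k⃗)` + the adjunction
inequality Thm. 1.8; in the tree this is the generalized-crossing-change input `hA` of
`MMSWMultiIndexMonotoneReduction`.)  Hypothesis-shaped, D-0026.
[cite: ManolescuMarengonSarkarWillis2023, Prop. 8.2 (iii)] -/
def ShadowUpperBound : Prop :=
  ∀ {k : ℕ} {K : 𝕊 1 → 𝔼 4} {s s₀ : ℤ}, HasSMinus k K s → (∀ t, wC (K t) ≠ 0) →
    ApproxHasRasmussen k 0 K s₀ → s ≤ s₀

/-- **MMSW Prop. 8.2 (iv)**: `s(D(0⃗)) ≤ s₊(K)`. [cite: ManolescuMarengonSarkarWillis2023, Prop. 8.2 (iv)] -/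
def ShadowLowerBound : Prop :=
  ∀ {k : ℕ} {K : 𝕊 1 → 𝔼 4} {s s₀ : ℤ}, HasSPlus k K s → (∀ t, wC (K t) ≠ 0) →
    ApproxHasRasmussen k 0 K s₀ → s₀ ≤ s

/-- **THE SHADOW SIEVE.**  A certificate `s₋(K) > 0` forces the shadow of every core-missing
picture of `K` to have POSITIVE ordinary Rasmussen invariant, and `s₊(K) < 0` forces it
NEGATIVE.  Contrapositive use (candidate triage, no threshold computation): an attaching circle
with some picture whose shadow is slice / amphichiral / has `s = 0` — e.g. every relator or
meridian curve of a `D(P)` diagram drawn without local knots, every winding-`0` wrapping-`2`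
satellite of a once-through companion (light bulb) — can never certify.
[cite: ManolescuMarengonSarkarWillis2023, Prop. 8.2 (iii)–(iv)] -/
theorem shadow_sign_of_certificate (hU : ShadowUpperBound) (hL : ShadowLowerBound) {k : ℕ}
    {K : 𝕊 1 → 𝔼 4} (w : MMSWRasmussen k K) (hw : ∀ t, wC (K t) ≠ 0) {s₀ : ℤ}
    (h0 : ApproxHasRasmussen k 0 K s₀) :
    (0 < w.sMinus → 0 < s₀) ∧ (w.sPlus < 0 → s₀ < 0) :=
  ⟨fun h => lt_of_lt_of_le h (hU w.hasSMinus hw h0),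
    fun h => lt_of_le_of_lt (hL w.hasSPlus hw h0) h⟩

/-- **No certificate from an `s = 0` shadow** (the form used to discard candidates).
[cite: ManolescuMarengonSarkarWillis2023, Prop. 8.2 (iii)–(iv)] -/
theorem no_certificate_of_shadow_zero (hU : ShadowUpperBound) (hL : ShadowLowerBound) {k : ℕ}
    {K : 𝕊 1 → 𝔼 4} (w : MMSWRasmussen k K) (hw : ∀ t, wC (K t) ≠ 0)
    (h0 : ApproxHasRasmussen k 0 K 0) : ¬ (0 < w.sMinus ∨ w.sPlus < 0) := by
  rintro (h | h)
  · exact lt_irrefl _ ((shadow_sign_of_certificate hU hL w hw h0).1 h)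
  · exact lt_irrefl _ ((shadow_sign_of_certificate hU hL w hw h0).2 h)

end Summit.SmoothPoincare4.SmoothPoincare4.Cruxes.DcrGap.StrategistR1

end
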